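import Literature.Combinatorics.SimpleGraph.GridFormulaCells
import Literature.Combinatorics.SimpleGraph.HamiltonianRailGadgets
import Literature.Combinatorics.SimpleGraph.HamiltonianRailPlacement
import Literature.Combinatorics.SimpleGraph.HamiltonianIteratedSubstitution
import HarnessLib

/-!
# The grid graph of a formula, II: the gadget family (XOR-chords and clause OR-gadgets)

The gadgets substituted into the chain of cells `GridFormula.cellsOf ψ` (`GridFormulaCells.lean`)
— all of them rail gadgets of the tree (`HamiltonianRailGadgets.lean`: `RailXOR`, `RailOR1`,
`RailOR3`), placed on numbered slots by `HamiltonianRailPlacement.lean` — and the validity of the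
family (the hypotheses of the iterated substitution theorem of `HamiltonianIteratedSubstitution.lean`).
Gadget indices: `8 (i N + j) + r` for the `r`-th gadget of tile `(i, j)` (`r = 0`: the row chord
from tile `(i, j-1)`; `r = 1, 2`: the two inner row chords of an `empty`/`tap` tile; `r = 1, …, 4`:
the four inner chords `c, r, κ, c′` of a `cross` tile; `r = 5`: the column chord from tile
`(i-1, j)` into a `cross` tile), then `8 V N + j` for the column chord landing on the clause-row
terminal of column `j` (on its top slot or its west slot, by the parity rule `landSlot`), then
`8 V N + N + q` for the OR-gadget of clause `q` (one or three inputs, on the bottom slots of the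
terminals of its columns). This is the executable specification `work4/construct3.py` of the
discharge notes, whose count was checked against `#SAT` by brute force; the count is proved in the
sequel.

* `xorAt?`, `or1At?`, `or3At?` — guarded placements; `GadSpec`, `gad ψ g` (the data-level
  specification of gadget `g`), `realize`, `place ψ g = (gad ψ g).bind (realize ψ g)`, **`family ψ`**;
* `place_spec` (base numbers, size bound, exclusivity, slot ownership `slotOwner`, table census),
  **`valid`**, `coverCount_family_some` / `coverCount_family_none`.

## References

* M. Liśkiewicz, M. Ogihara, S. Toda, TCS 304 (2003) 129–156, §3 (proof of Lemma 4).
* M. R. Garey, D. S. Johnson, *Computers and Intractability*, Freeman 1979, §3.2.2.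
-/

namespace Literature.Combinatorics.SimpleGraph

namespace GridFormula

open GridCell GridCell.CellTy Literature.Computability.Complexity Slot

variable (ψ : CNF ℕ)

/-! ### Oriented slots

A placed rail runs from the first to the second vertex of its slot; for the grid drawing of the
sequel two slots of the odd parity cell are used in the reversed orientation (so that the four rungs
of every chord nest).  The admissible oriented slots of each cell type are listed in `canon`; no
list contains a pair together with its reversal. -/

/-- The (unused) top-west slot of the odd parity cell. [folklore] -/
def tN0 : Fin 16 × Fin 16 := (12, 13)

/-- The reversed bottom-middle slot of the odd parity cell. [folklore] -/
def tS4r : Fin 16 × Fin 16 := (2, 1)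

/-- The reversed top-east slot of the odd parity cell. [folklore] -/
def tN2r : Fin 16 × Fin 16 := (15, 14)

/-- **The admissible oriented slots** of each cell type. [folklore] -/
def canon : CellTy → List (Fin 16 × Fin 16)
  | .bead => [bN0, bN3, bN6, bS0, bS1]
  | .pc => [pN0, pN4, pN8, pS0, pS2]
  | .pct => [tN0, tN2r, tS0, tS4r, tS8]

/-- Admissible oriented slots are proper edges of their cell. [folklore] -/
theorem canon_ok : ∀ ty : CellTy, ∀ e ∈ canon ty, e.1 ≠ e.2 ∧ ty.adjB e.1 e.2 = true := by
  intro ty; cases ty <;> simp only [canon, List.mem_cons, List.not_mem_nil, or_false, forall_eq_or_imp, forall_eq] <;> decide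

/-- No admissible list contains a slot together with its reversal. [folklore] -/
theorem canon_swap : ∀ ty : CellTy, ∀ e ∈ canon ty, (e.2, e.1) ∉ canon ty := by
  intro ty; cases ty <;> simp only [canon, List.mem_cons, List.not_mem_nil, or_false, forall_eq_or_imp, forall_eq] <;> decide

variable {ψ} in
/-- An admissible slot is a proper pair. [folklore] -/
theorem ne_of_canon {ty : CellTy} {e : Fin 16 × Fin 16} (h : e ∈ canon ty) : e.1 ≠ e.2 := ((canon_ok ty) e h).1

variable {ψ} in
/-- An admissible slot is a cell edge. [folklore] -/
theorem adjB_of_canon {ty : CellTy} {e : Fin 16 × Fin 16} (h : e ∈ canon ty) : ty.adjB e.1 e.2 = true := ((canon_ok ty) e h).2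

/-! ### Guarded placements -/

/-- The first numbered inner vertex of gadget `g` (above all chain vertices). [folklore] -/
def gbase (g : ℕ) : ℕ := 17 * ncells ψ + 64 * g

/-- Block vertices of cells are below every gadget base. [folklore] -/
theorem vtx_lt_gbase {k : ℕ} (hk : k < ncells ψ) (a : Fin 16) (g : ℕ) : vtx k a < gbase ψ g := by
  unfold vtx gbase; have := a.isLt; nlinarith

/-- **The XOR-chord between the slot `e₁` of cell `k₁` and the slot `e₂` of cell `k₂`** (guarded:
both cells exist and differ, both edges are proper). [folklore] -/
def xorAt? (g k₁ : ℕ) (e₁ : Fin 16 × Fin 16) (k₂ : ℕ) (e₂ : Fin 16 × Fin 16) : Option RailPlacement :=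
  if h : k₁ < ncells ψ ∧ k₂ < ncells ψ ∧ k₁ ≠ k₂ ∧ e₁.1 ≠ e₁.2 ∧ e₂.1 ≠ e₂.2 then
    some
      { k := 2, K := 4, m := 4, Γ := RailXOR.Γ, base := gbase ψ g
        ends := fun r => if r = 0 then gs k₁ e₁ else gs k₂ e₂
        ends_lt := fun r => by
          split_ifs <;> exact ⟨vtx_lt_gbase ψ (by tauto) _ _, vtx_lt_gbase ψ (by tauto) _ _⟩
        ends_ne := fun r => by
          split_ifs
          · exact fun he => h.2.2.2.1 (vtx_injective _ he)
          · exact fun he => h.2.2.2.2 (vtx_injective _ he)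
        ends_distinct := fun r r' hrr => by
          have hcases : ∀ s : Fin 2, s = 0 ∨ s = 1 := by decide
          have hk := h.2.2.1
          rcases hcases r with rfl | rfl <;> rcases hcases r' with rfl | rfl
          · exact absurd rfl hrr
          · simp only [↓reduceIte, Fin.one_eq_zero_iff, OfNat.ofNat_ne_one, gs, ne_eq, vtx_inj]; tauto
          · simp only [Fin.one_eq_zero_iff, OfNat.ofNat_ne_one, ↓reduceIte, gs, ne_eq, vtx_inj]; tauto
          · exact absurd rfl hrr }
  else none

/-- **The one-input OR-gadget on the bottom slot of the terminal `k`** (guarded). [folklore] -/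
def or1At? (g k : ℕ) : Option RailPlacement :=
  if h : k < ncells ψ then
    some
      { k := 1, K := 2, m := 1, Γ := RailOR1.Γ, base := gbase ψ g
        ends := fun _ => gs k bS0
        ends_lt := fun _ => ⟨vtx_lt_gbase ψ h _ _, vtx_lt_gbase ψ h _ _⟩
        ends_ne := fun _ he => absurd (vtx_injective _ he) (by decide)
        ends_distinct := fun r r' hrr => absurd (Subsingleton.elim r r') hrr }
  else none

/-- **The three-input OR-gadget on the bottom slots of the terminals `k, k+1, k+2`** (guarded).
[folklore] -/
def or3At? (g k : ℕ) : Option RailPlacement :=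
  if h : k + 2 < ncells ψ then
    some
      { k := 3, K := 6, m := 9, Γ := RailOR3.Γ, base := gbase ψ g
        ends := fun r => gs (k + r.val) bS0
        ends_lt := fun r => ⟨vtx_lt_gbase ψ (by omega) _ _, vtx_lt_gbase ψ (by omega) _ _⟩
        ends_ne := fun _ he => absurd (vtx_injective _ he) (by decide)
        ends_distinct := fun r r' hrr => by
          have : k + r.val ≠ k + r'.val := fun h' => hrr (Fin.ext (by omega))
          simp only [gs, ne_eq, vtx_inj]; tauto }
  else none

/-! ### Clause bookkeeping -/

/-- The first column of clause `q`. [folklore] -/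
def cstart (q : ℕ) : ℕ := (ψ.take q).flatten.length

/-- `cstart 0 = 0`. [folklore] -/
@[simp] theorem cstart_zero : cstart ψ 0 = 0 := by simp [cstart]

/-- The columns of clause `q` follow those of the earlier clauses. [folklore] -/
theorem cstart_succ {q : ℕ} (hq : q < ψ.length) : cstart ψ (q + 1) = cstart ψ q + ψ[q].length := by
  unfold cstart
  rw [List.take_add_one, List.getElem?_eq_getElem hq, Option.toList_some, List.flatten_append,
    List.length_append, List.flatten_cons, List.flatten_nil, List.append_nil]

/-- All columns: `cstart |ψ| = N`. [folklore] -/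
theorem cstart_length : cstart ψ ψ.length = N ψ := by simp [cstart, N, cols]

/-- `cstart` is monotone. [folklore] -/
theorem cstart_mono {q q' : ℕ} (h : q ≤ q') : cstart ψ q ≤ cstart ψ q' := by
  unfold cstart
  obtain ⟨d, rfl⟩ := Nat.exists_eq_add_of_le h
  rw [List.take_add, List.flatten_append, List.length_append]
  omega

/-- The columns of a clause are columns. [folklore] -/
theorem cstart_add_lt {q : ℕ} (hq : q < ψ.length) {m : ℕ} (hm : m < ψ[q].length) : cstart ψ q + m < N ψ := by
  have h1 := cstart_succ ψ hq
  have h2 := cstart_mono ψ (show q + 1 ≤ ψ.length from hq)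
  rw [cstart_length] at h2
  omega

/-! ### Slots of the ports of a tile -/

/-- The local slot by which a row wire ENTERS tile `(i, j)` (cell `0`). [folklore] -/
def rowInSlot (i j : ℕ) : Fin 16 × Fin 16 := if tileTy ψ i j = .cross then pN0 else bN3

/-- The local slot by which a row wire LEAVES tile `(i, j)` (cell `2`). [folklore] -/
def rowOutSlot (i j : ℕ) : Fin 16 × Fin 16 := if tileTy ψ i j = .cross then pN8 else bN6

/-- The local slot by which a column wire LEAVES tile `(i, j)` (cell `1`; taps and crossings).
[folklore] -/
def colOutSlot (i j : ℕ) : Fin 16 × Fin 16 := if tileTy ψ i j = .tap then bS1 else tS8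

/-- **The landing slot of column `j`** on its clause-row terminal: the top slot (bit) or the west
slot (¬bit), chosen by the parity of the number of crossings below the tap and the polarity of the
literal, so that the terminal's bit is the value of the literal. [folklore] -/
def landSlot (j : ℕ) : Fin 16 × Fin 16 :=
  if (V ψ - 1 - rowOf ψ (varOf ψ j)) % 2 = (if polOf ψ j then 0 else 1) then bN3 else bN0

/-! ### The specification and the placement of every gadget -/

/-- **A gadget specification**: an XOR-chord between two global slots, or an OR-gadget on the bottom
slots of one or three consecutive clause-row terminals. [folklore] -/
inductive GadSpec
  | xor (k₁ : ℕ) (e₁ : Fin 16 × Fin 16) (k₂ : ℕ) (e₂ : Fin 16 × Fin 16)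
  | or1 (k : ℕ)
  | or3 (k : ℕ)
  deriving DecidableEq

/-- Realising a specification as a guarded placement. [folklore] -/
def realize (g : ℕ) : GadSpec → Option RailPlacement
  | .xor k₁ e₁ k₂ e₂ => xorAt? ψ g k₁ e₁ k₂ e₂
  | .or1 k => or1At? ψ g k
  | .or3 k => or3At? ψ g k

/-- **The `r`-th gadget of tile `(i, j)`.** [folklore] -/
def tileGad (i j r : ℕ) : Option GadSpec :=
  if tileTy ψ i j = .cross then
    (if r = 0 then (if j = 0 then none else some (.xor (tileCell ψ i (j - 1) 2) (rowOutSlot ψ i (j - 1)) (tileCell ψ i j 0) pN0))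
    else if r = 1 then some (.xor (tileCell ψ i j 0) pS2 (tileCell ψ i j 1) tS0)
    else if r = 2 then some (.xor (tileCell ψ i j 0) pS0 (tileCell ψ i j 1) tS4r)
    else if r = 3 then some (.xor (tileCell ψ i j 1) tN2r (tileCell ψ i j 2) pN0)
    else if r = 4 then some (.xor (tileCell ψ i j 0) pN8 (tileCell ψ i j 2) pN4)
    else if r = 5 then some (.xor (tileCell ψ (i - 1) j 1) (colOutSlot ψ (i - 1) j) (tileCell ψ i j 0) pN4)
    else none)
  else
    (if r = 0 then (if j = 0 then none else some (.xor (tileCell ψ i (j - 1) 2) (rowOutSlot ψ i (j - 1)) (tileCell ψ i j 0) bN3))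
    else if r = 1 then some (.xor (tileCell ψ i j 0) bN6 (tileCell ψ i j 1) bN3)
    else if r = 2 then some (.xor (tileCell ψ i j 1) bN6 (tileCell ψ i j 2) bN3)
    else none)

/-- **The OR-gadget of clause `q`** (one or three inputs; `none` for other widths). [folklore] -/
def clauseGad (q : ℕ) : Option GadSpec :=
  if hq : q < ψ.length then
    (if ψ[q].length = 1 then some (.or1 (clauseBead ψ (cstart ψ q)))
    else if ψ[q].length = 3 then some (.or3 (clauseBead ψ (cstart ψ q)))
    else none)
  else none

/-- **The specification of gadget `g`** (`none`: no gadget). [folklore] -/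
def gad (g : ℕ) : Option GadSpec :=
  if g < 8 * (V ψ * N ψ) then tileGad ψ (g / 8 / N ψ) (g / 8 % N ψ) (g % 8)
  else if g - 8 * (V ψ * N ψ) < N ψ then
    some (.xor (tileCell ψ (V ψ - 1) (g - 8 * (V ψ * N ψ)) 1) (colOutSlot ψ (V ψ - 1) (g - 8 * (V ψ * N ψ)))
      (clauseBead ψ (g - 8 * (V ψ * N ψ))) (landSlot ψ (g - 8 * (V ψ * N ψ))))
  else clauseGad ψ (g - 8 * (V ψ * N ψ) - N ψ)

/-- **The placement of gadget `g`**: its specification realised. [folklore] -/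
def place (g : ℕ) : Option RailPlacement := (gad ψ g).bind (realize ψ g)

/-- **The gadget family of `ψ`.** [folklore] -/
def family : GadgetFamily ℕ where
  S g := (place ψ g).elim ∅ RailPlacement.S
  GX g := (place ψ g).elim ⊥ RailPlacement.GX
  VX g := (place ψ g).elim ∅ RailPlacement.VX

/-- The number of gadget indices. [folklore] -/
def ngadgets : ℕ := 8 * (V ψ * N ψ) + N ψ + ψ.length

/-- The slots of the family. [folklore] -/
@[simp] theorem family_S (g : ℕ) : (family ψ).S g = (place ψ g).elim ∅ RailPlacement.S := rfl
/-- The gadget graphs of the family. [folklore] -/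
@[simp] theorem family_GX (g : ℕ) : (family ψ).GX g = (place ψ g).elim ⊥ RailPlacement.GX := rfl
/-- The gadget vertices of the family. [folklore] -/
@[simp] theorem family_VX (g : ℕ) : (family ψ).VX g = (place ψ g).elim ∅ RailPlacement.VX := rfl

/-! ### Specifications of the guarded placements -/

/-- A placed gadget with its structural data: base number, at most 64 inner vertices, an exclusive
template, every slot end a proper increasing cell edge `gs k e` of an existing cell of the right type
drawn from a given list of admissible `(k, e)`, and a 0/1 table census. [folklore] -/
structure PlacedOK (g : ℕ) (adm : List (ℕ × (Fin 16 × Fin 16))) (tab : Finset (ℕ × ℕ) → Bool) (P : RailPlacement) : Prop where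
  base_eq : P.base = gbase ψ g
  size_le : P.k * P.K + P.m ≤ 64
  excl : Exclusive P.Γ.graph P.Γ.VX P.Γ.slots
  ends_adm : ∀ r, ∃ ke ∈ adm, P.ends r = gs ke.1 ke.2
  adm_ok : ∀ ke ∈ adm, ke.1 < ncells ψ ∧ (cellTyAt ψ ke.1).adjB ke.2.1 ke.2.2 = true ∧ ke.2 ∈ canon (cellTyAt ψ ke.1)
  census : ∀ U ⊆ P.S, coverCount P.GX P.VX U = if tab U = true then 1 else 0

/-- Distinct rails have distinct slots, so `P.ends` is injective (local copy; the same statement is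
`RailPlacement.card_image_ends` of `HamiltonianLOTFamilies.lean`, whose import closure is not wanted
here). [folklore] -/
private theorem placementEnds_injective (P : RailPlacement) :
    Function.Injective P.ends := fun r r' h => by
  by_contra hne
  exact (P.ends_distinct r r' hne).1 (by rw [h])

/-- Cardinality of an image under `P.ends` (local copy, see above). [folklore] -/
private theorem card_image_placementEnds (P : RailPlacement) (U₀ : Finset (Fin P.k)) :
    (U₀.image P.ends).card = U₀.card :=
  Finset.card_image_of_injective _ (placementEnds_injective P)

/-- The XOR table: exactly one slot. [folklore] -/
def xorTab (U : Finset (ℕ × ℕ)) : Bool := decide (U.card = 1)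

/-- The OR table: at least one slot. [folklore] -/
def orTab (U : Finset (ℕ × ℕ)) : Bool := !decide (U = ∅)

/-- **Specification of `xorAt?`.** [folklore] -/
theorem xorAt?_spec {g k₁ k₂ : ℕ} {e₁ e₂ : Fin 16 × Fin 16} {P : RailPlacement}
    (h : xorAt? ψ g k₁ e₁ k₂ e₂ = some P)
    (ho₁ : e₁ ∈ canon (cellTyAt ψ k₁)) (ho₂ : e₂ ∈ canon (cellTyAt ψ k₂)) :
    PlacedOK ψ g [(k₁, e₁), (k₂, e₂)] xorTab P := by
  have h₁ := adjB_of_canon ho₁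
  have h₂ := adjB_of_canon ho₂
  unfold xorAt? at h
  split_ifs at h with hg
  simp only [Option.some.injEq] at h
  subst h
  refine ⟨rfl, show 2 * 4 + 4 ≤ 64 by decide, RailXOR.exclusive, fun r => ?_, fun ke hke => ?_, fun U hU => ?_⟩
  · have : ∀ s : Fin 2, s = 0 ∨ s = 1 := by decide
    rcases this r with rfl | rfl
    · exact ⟨(k₁, e₁), by simp, by simp⟩
    · exact ⟨(k₂, e₂), by simp, by simp⟩
  · simp only [List.mem_cons, List.not_mem_nil, or_false] at hke
    rcases hke with rfl | rfl
    exacts [⟨hg.1, h₁, ho₁⟩, ⟨hg.2.1, h₂, ho₂⟩]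
  · set P : RailPlacement := { k := 2, K := 4, m := 4, Γ := RailXOR.Γ, base := gbase ψ g, ends := fun r => if r = 0 then gs k₁ e₁ else gs k₂ e₂, ends_lt := _, ends_ne := _, ends_distinct := _ } with hP
    obtain ⟨U₀, rfl⟩ := P.exists_eq_image_ends hU
    rw [P.coverCount_image, RailXOR.coverCount_eq _ (Finset.image_subset_iff.2 fun r _ => RailXOR.Γ.mem_slots_iff.2 ⟨r, rfl⟩),
      Finset.card_image_of_injective _ RailXOR.Γ.slot_injective, xorTab, card_image_placementEnds P]
    simp only [decide_eq_true_eq]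

/-- **Specification of `or1At?`.** [folklore] -/
theorem or1At?_spec {g k : ℕ} {P : RailPlacement} (h : or1At? ψ g k = some P) (hk : cellTyAt ψ k = .bead) :
    PlacedOK ψ g [(k, bS0)] orTab P := by
  unfold or1At? at h
  split_ifs at h with hg
  simp only [Option.some.injEq] at h
  subst h
  have hadj : (cellTyAt ψ k).adjB bS0.1 bS0.2 = true := by rw [hk]; decide
  refine ⟨rfl, show 1 * 2 + 1 ≤ 64 by decide, RailOR1.exclusive, fun r => ⟨(k, bS0), by simp, rfl⟩, fun ke hke => ?_, fun U hU => ?_⟩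
  · rw [List.mem_singleton] at hke
    subst hke
    exact ⟨hg, hadj, by rw [hk]; exact (by decide : bS0 ∈ canon CellTy.bead)⟩
  · set P : RailPlacement := { k := 1, K := 2, m := 1, Γ := RailOR1.Γ, base := gbase ψ g, ends := fun _ => gs k bS0, ends_lt := _, ends_ne := _, ends_distinct := _ } with hP
    obtain ⟨U₀, rfl⟩ := P.exists_eq_image_ends hU
    rw [P.coverCount_image, RailOR1.coverCount_eq _ (Finset.image_subset_iff.2 fun r _ => RailOR1.Γ.mem_slots_iff.2 ⟨r, rfl⟩)]
    by_cases h0 : U₀ = ∅ <;> simp [orTab, h0]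

/-- **Specification of `or3At?`.** [folklore] -/
theorem or3At?_spec {g k : ℕ} {P : RailPlacement} (h : or3At? ψ g k = some P)
    (hk : ∀ m < 3, cellTyAt ψ (k + m) = .bead) :
    PlacedOK ψ g [(k, bS0), (k + 1, bS0), (k + 2, bS0)] orTab P := by
  unfold or3At? at h
  split_ifs at h with hg
  simp only [Option.some.injEq] at h
  subst h
  have hadj : ∀ m < 3, (cellTyAt ψ (k + m)).adjB bS0.1 bS0.2 = true := fun m hm => by rw [hk m hm]; decide
  have ho : ∀ m < 3, bS0 ∈ canon (cellTyAt ψ (k + m)) := fun m hm => by rw [hk m hm]; exact (by decide : bS0 ∈ canon CellTy.bead)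
  refine ⟨rfl, show 3 * 6 + 9 ≤ 64 by decide, RailOR3.exclusive, fun r => ?_, fun ke hke => ?_, fun U hU => ?_⟩
  · have : ∀ s : Fin 3, s = 0 ∨ s = 1 ∨ s = 2 := by decide
    rcases this r with rfl | rfl | rfl
    · exact ⟨(k, bS0), by simp, by simp⟩
    · exact ⟨(k + 1, bS0), by simp, rfl⟩
    · exact ⟨(k + 2, bS0), by simp, rfl⟩
  · simp only [List.mem_cons, List.not_mem_nil, or_false] at hke
    rcases hke with rfl | rfl | rfl
    · exact ⟨by omega, hadj 0 (by omega), ho 0 (by omega)⟩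
    · exact ⟨by omega, hadj 1 (by omega), ho 1 (by omega)⟩
    · exact ⟨by omega, hadj 2 (by omega), ho 2 (by omega)⟩
  · set P : RailPlacement := { k := 3, K := 6, m := 9, Γ := RailOR3.Γ, base := gbase ψ g, ends := fun r => gs (k + r.val) bS0, ends_lt := _, ends_ne := _, ends_distinct := _ } with hP
    obtain ⟨U₀, rfl⟩ := P.exists_eq_image_ends hU
    rw [P.coverCount_image, RailOR3.coverCount_eq _ (Finset.image_subset_iff.2 fun r _ => RailOR3.Γ.mem_slots_iff.2 ⟨r, rfl⟩)]
    by_cases h0 : U₀ = ∅ <;> simp [orTab, h0]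

/-! ### Ownership of slots -/

/-- The gadget meant to use the column-out slot of tile `(i, j)`: the column chord into the crossing
below, or the landing chord when `(i, j)` is in the last row. [folklore] -/
def colOwner (i j : ℕ) : ℕ := if i + 1 < V ψ then 8 * ((i + 1) * N ψ + j) + 5 else 8 * (V ψ * N ψ) + j

/-- **The gadget meant to use the local slot `e` of cell `c` of tile `(i, j)`** (of the given kind).
[folklore] -/
def ownerTile (i j c : ℕ) (cross : Bool) (e : Fin 16 × Fin 16) : ℕ :=
  if cross then
    (if c = 0 then (if e = pN0 then 8 * (i * N ψ + j) else if e = pN4 then 8 * (i * N ψ + j) + 5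
        else if e = pS2 then 8 * (i * N ψ + j) + 1 else if e = pS0 then 8 * (i * N ψ + j) + 2 else 8 * (i * N ψ + j) + 4)
      else if c = 1 then (if e = tS0 then 8 * (i * N ψ + j) + 1 else if e = tS4r then 8 * (i * N ψ + j) + 2
        else if e = tN2r then 8 * (i * N ψ + j) + 3 else colOwner ψ i j)
      else (if e = pN0 then 8 * (i * N ψ + j) + 3 else if e = pN4 then 8 * (i * N ψ + j) + 4 else 8 * (i * N ψ + j + 1)))
  else
    (if c = 0 then (if e = bN3 then 8 * (i * N ψ + j) else 8 * (i * N ψ + j) + 1)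
      else if c = 1 then (if e = bN3 then 8 * (i * N ψ + j) + 1 else if e = bN6 then 8 * (i * N ψ + j) + 2 else colOwner ψ i j)
      else (if e = bN3 then 8 * (i * N ψ + j) + 2 else 8 * (i * N ψ + j + 1)))

/-- The clause of column `j`: the number of clauses ending at or before `j`. [folklore] -/
def colClause (j : ℕ) : ℕ := ((List.range ψ.length).filter fun q => cstart ψ (q + 1) ≤ j).length

/-- **The gadget meant to use the local slot `e` of cell `k`.** [folklore] -/
def slotOwner (k : ℕ) (e : Fin 16 × Fin 16) : ℕ :=
  if k < 1 + 3 * (V ψ * N ψ) then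
    ownerTile ψ ((k - 1) / 3 / N ψ) ((k - 1) / 3 % N ψ) ((k - 1) % 3)
      (decide (tileTy ψ ((k - 1) / 3 / N ψ) ((k - 1) / 3 % N ψ) = .cross)) e
  else if e = bS0 then 8 * (V ψ * N ψ) + N ψ + colClause ψ (k - (1 + 3 * (V ψ * N ψ)))
  else 8 * (V ψ * N ψ) + (k - (1 + 3 * (V ψ * N ψ)))

/-- `slotOwner` on a tile cell. [folklore] -/
theorem slotOwner_tileCell {i j c : ℕ} (hi : i < V ψ) (hj : j < N ψ) (hc : c < 3) (e : Fin 16 × Fin 16) :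
    slotOwner ψ (tileCell ψ i j c) e = ownerTile ψ i j c (decide (tileTy ψ i j = .cross)) e := by
  obtain ⟨h1, h2, h3⟩ := tileCell_arith ψ (i := i) hj hc
  unfold slotOwner
  rw [if_pos (tileCell_lt ψ hi hj hc), h1, h2, h3]

/-- `slotOwner` on a clause-row terminal. [folklore] -/
theorem slotOwner_clauseBead (j : ℕ) (e : Fin 16 × Fin 16) :
    slotOwner ψ (clauseBead ψ j) e = if e = bS0 then 8 * (V ψ * N ψ) + N ψ + colClause ψ j else 8 * (V ψ * N ψ) + j := by
  unfold slotOwner clauseBead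
  rw [if_neg (by omega), show 1 + 3 * (V ψ * N ψ) + j - (1 + 3 * (V ψ * N ψ)) = j by omega]

/-- A filter of `range n` by a threshold. [folklore] -/
theorem length_filter_range_lt (q : ℕ) : ∀ n, q ≤ n → ((List.range n).filter fun q' => decide (q' < q)).length = q
  | 0, h => by simp at h; subst h; rfl
  | n + 1, h => by
    rw [List.range_succ, List.filter_append, List.length_append]
    rcases Nat.eq_or_lt_of_le h with rfl | hlt
    · rw [List.filter_singleton, List.filter_eq_self.2 fun q' hq' => by simpa using Nat.lt_succ_of_lt (List.mem_range.1 hq'),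
        List.length_range]
      simp
    · rw [length_filter_range_lt q n (Nat.lt_succ_iff.1 hlt), List.filter_singleton]
      simp [show ¬ n < q from not_lt.2 (Nat.lt_succ_iff.1 hlt)]

/-- **The clause of a column of clause `q` is `q`.** [folklore] -/
theorem colClause_cstart_add {q : ℕ} (hq : q < ψ.length) {m : ℕ} (hm : m < ψ[q].length) :
    colClause ψ (cstart ψ q + m) = q := by
  unfold colClause
  have hfilt : ((List.range ψ.length).filter fun q' => decide (cstart ψ (q' + 1) ≤ cstart ψ q + m)) =
      (List.range ψ.length).filter fun q' => decide (q' < q) := by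
    refine List.filter_congr fun q' _ => ?_
    simp only [decide_eq_decide]
    constructor
    · intro h
      by_contra hge
      have := cstart_mono ψ (show q + 1 ≤ q' + 1 by omega)
      rw [cstart_succ ψ hq] at this
      omega
    · intro h
      exact (cstart_mono ψ (show q' + 1 ≤ q by omega)).trans (Nat.le_add_right _ _)
  rw [hfilt, length_filter_range_lt q ψ.length hq.le]

/-- The table of gadget `g`: XOR for chords, OR for the clause gadgets. [folklore] -/
def tabOf (g : ℕ) : Finset (ℕ × ℕ) → Bool := if g < 8 * (V ψ * N ψ) + N ψ then xorTab else orTab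

/-- Decoding a tile-gadget index. [folklore] -/
theorem decode_tile {g : ℕ} (hg : g < 8 * (V ψ * N ψ)) :
    g / 8 / N ψ < V ψ ∧ g / 8 % N ψ < N ψ ∧ g = 8 * (g / 8 / N ψ * N ψ + g / 8 % N ψ) + g % 8 := by
  have hN : 0 < N ψ := Nat.pos_of_ne_zero fun h => by rw [h] at hg; simp at hg
  have ht : g / 8 < V ψ * N ψ := by omega
  refine ⟨(Nat.div_lt_iff_lt_mul hN).2 ht, Nat.mod_lt _ hN, ?_⟩
  have := Nat.div_add_mod (g / 8) (N ψ)
  have := Nat.div_add_mod g 8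
  rw [Nat.mul_comm] at *
  nlinarith [Nat.div_add_mod (g / 8) (N ψ), Nat.div_add_mod g 8]

/-! ### The specification of every placed gadget -/

/-- The conclusion of `place_spec`. [folklore] -/
def PlaceSpec (g : ℕ) (P : RailPlacement) : Prop :=
  P.base = gbase ψ g ∧ P.k * P.K + P.m ≤ 64 ∧ Exclusive P.Γ.graph P.Γ.VX P.Γ.slots ∧
    (∀ r, ∃ k e, P.ends r = gs k e ∧ k < ncells ψ ∧ (cellTyAt ψ k).adjB e.1 e.2 = true ∧ e ∈ canon (cellTyAt ψ k) ∧ slotOwner ψ k e = g) ∧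
    (∀ U ⊆ P.S, coverCount P.GX P.VX U = if tabOf ψ g U = true then 1 else 0)

variable {ψ} in
/-- From a guarded placement with owned admissible slots to the specification. [folklore] -/
theorem PlacedOK.placeSpec {g : ℕ} {adm : List (ℕ × (Fin 16 × Fin 16))} {tab : Finset (ℕ × ℕ) → Bool} {P : RailPlacement}
    (h : PlacedOK ψ g adm tab P) (hown : ∀ ke ∈ adm, slotOwner ψ ke.1 ke.2 = g) (htab : tabOf ψ g = tab) :
    PlaceSpec ψ g P := by
  refine ⟨h.base_eq, h.size_le, h.excl, fun r => ?_, by rw [htab]; exact h.census⟩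
  obtain ⟨ke, hke, hr⟩ := h.ends_adm r
  obtain ⟨h1, h2, h3⟩ := h.adm_ok ke hke
  exact ⟨ke.1, ke.2, hr, h1, h2, h3, hown ke hke⟩

/-- The number of columns is positive as soon as some gadget index is in range. [folklore] -/
theorem N_pos_of_lt {g : ℕ} (hg : g < 8 * (V ψ * N ψ) + N ψ) : 0 < N ψ := by
  rcases Nat.eq_zero_or_pos (N ψ) with h | h
  · rw [h] at hg; simp at hg
  · exact h

/-- Types of tile cells, named. [folklore] -/
theorem cellTyAt_tileCell_cases {i j : ℕ} (hi : i < V ψ) (hj : j < N ψ) :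
    (tileTy ψ i j = .cross → cellTyAt ψ (tileCell ψ i j 0) = .pc ∧ cellTyAt ψ (tileCell ψ i j 1) = .pct ∧ cellTyAt ψ (tileCell ψ i j 2) = .pc) ∧
    (tileTy ψ i j ≠ .cross → ∀ c < 3, cellTyAt ψ (tileCell ψ i j c) = .bead) := by
  refine ⟨fun h => ?_, fun h c hc => ?_⟩
  · rw [cellTyAt_tileCell ψ hi hj (by omega), cellTyAt_tileCell ψ hi hj (by omega), cellTyAt_tileCell ψ hi hj (by omega)]
    simp [h]
  · rw [cellTyAt_tileCell ψ hi hj hc, if_neg h]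

/-- Evaluations of `ownerTile` used below (the slot constants are pairwise distinct where compared).
[folklore] -/
theorem ownerTile_vals (i j : ℕ) :
    ownerTile ψ i j 0 true pN0 = 8 * (i * N ψ + j) ∧ ownerTile ψ i j 0 true pN4 = 8 * (i * N ψ + j) + 5 ∧
    ownerTile ψ i j 0 true pS2 = 8 * (i * N ψ + j) + 1 ∧ ownerTile ψ i j 0 true pS0 = 8 * (i * N ψ + j) + 2 ∧
    ownerTile ψ i j 0 true pN8 = 8 * (i * N ψ + j) + 4 ∧
    ownerTile ψ i j 1 true tS0 = 8 * (i * N ψ + j) + 1 ∧ ownerTile ψ i j 1 true tS4r = 8 * (i * N ψ + j) + 2 ∧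
    ownerTile ψ i j 1 true tN2r = 8 * (i * N ψ + j) + 3 ∧ ownerTile ψ i j 1 true tS8 = colOwner ψ i j ∧
    ownerTile ψ i j 2 true pN0 = 8 * (i * N ψ + j) + 3 ∧ ownerTile ψ i j 2 true pN4 = 8 * (i * N ψ + j) + 4 ∧
    ownerTile ψ i j 2 true pN8 = 8 * (i * N ψ + j + 1) ∧
    ownerTile ψ i j 0 false bN3 = 8 * (i * N ψ + j) ∧ ownerTile ψ i j 0 false bN6 = 8 * (i * N ψ + j) + 1 ∧
    ownerTile ψ i j 1 false bN3 = 8 * (i * N ψ + j) + 1 ∧ ownerTile ψ i j 1 false bN6 = 8 * (i * N ψ + j) + 2 ∧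
    ownerTile ψ i j 1 false bS1 = colOwner ψ i j ∧
    ownerTile ψ i j 2 false bN3 = 8 * (i * N ψ + j) + 2 ∧ ownerTile ψ i j 2 false bN6 = 8 * (i * N ψ + j + 1) := by
  simp (config := { decide := true }) [ownerTile]

/-- The two tile types occurring ABOVE OR AT a given row of a column: below the variable's row every
tile is a crossing, on it a tap. [folklore] -/
theorem tileTy_ne_empty_of_le {i j : ℕ} (h : rowOf ψ (varOf ψ j) ≤ i) : tileTy ψ i j ≠ .empty := by
  rw [ne_eq, tileTy_eq_empty_iff]; omega

/-- The slot and the cell type of the column-out port of a tap or a crossing. [folklore] -/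
theorem colOutSlot_adj {i j : ℕ} (hi : i < V ψ) (hj : j < N ψ) (h : tileTy ψ i j ≠ .empty) :
    (cellTyAt ψ (tileCell ψ i j 1)).adjB (colOutSlot ψ i j).1 (colOutSlot ψ i j).2 = true ∧
    colOutSlot ψ i j ∈ canon (cellTyAt ψ (tileCell ψ i j 1)) ∧
    ownerTile ψ i j 1 (decide (tileTy ψ i j = .cross)) (colOutSlot ψ i j) = colOwner ψ i j := by
  unfold colOutSlot
  by_cases hc : tileTy ψ i j = .cross
  · have h1 := ((cellTyAt_tileCell_cases ψ hi hj).1 hc).2.1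
    have hne : tileTy ψ i j ≠ .tap := by rw [hc]; decide
    rw [if_neg hne, h1, decide_eq_true hc, (ownerTile_vals ψ i j).2.2.2.2.2.2.2.2.1]
    exact ⟨by decide, by decide, rfl⟩
  · have ht : tileTy ψ i j = .tap := by
      cases h' : tileTy ψ i j <;> simp_all
    have h1 := (cellTyAt_tileCell_cases ψ hi hj).2 hc 1 (by omega)
    rw [if_pos ht, h1, show decide (tileTy ψ i j = TileTy.cross) = false from decide_eq_false hc,
      (ownerTile_vals ψ i j).2.2.2.2.2.2.2.2.2.2.2.2.2.2.2.2.1]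
    exact ⟨by decide, by decide, rfl⟩

/-- The slot and the cell type of the row-out port of a tile. [folklore] -/
theorem rowOutSlot_adj {i j : ℕ} (hi : i < V ψ) (hj : j < N ψ) :
    (cellTyAt ψ (tileCell ψ i j 2)).adjB (rowOutSlot ψ i j).1 (rowOutSlot ψ i j).2 = true ∧
    rowOutSlot ψ i j ∈ canon (cellTyAt ψ (tileCell ψ i j 2)) ∧
    ownerTile ψ i j 2 (decide (tileTy ψ i j = .cross)) (rowOutSlot ψ i j) = 8 * (i * N ψ + j + 1) := by
  unfold rowOutSlot
  by_cases hc : tileTy ψ i j = .cross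
  · have h1 := ((cellTyAt_tileCell_cases ψ hi hj).1 hc).2.2
    rw [if_pos hc, h1, decide_eq_true hc, (ownerTile_vals ψ i j).2.2.2.2.2.2.2.2.2.2.2.1]
    exact ⟨by decide, by decide, rfl⟩
  · have h1 := (cellTyAt_tileCell_cases ψ hi hj).2 hc 2 (by omega)
    rw [if_neg hc, h1, show decide (tileTy ψ i j = TileTy.cross) = false from decide_eq_false hc,
      (ownerTile_vals ψ i j).2.2.2.2.2.2.2.2.2.2.2.2.2.2.2.2.2.2]
    exact ⟨by decide, by decide, rfl⟩

/-- The landing slot is a proper increasing edge of the one-bit cell, not its bottom slot. [folklore] -/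
theorem landSlot_props (j : ℕ) : bead.adjB (landSlot ψ j).1 (landSlot ψ j).2 = true ∧
    landSlot ψ j ∈ canon .bead ∧ landSlot ψ j ≠ bS0 := by
  unfold landSlot; split_ifs <;> decide

/-- **The specification of every placed gadget.** [folklore] -/
theorem place_spec {g : ℕ} {P : RailPlacement} (hP : place ψ g = some P) : PlaceSpec ψ g P := by
  unfold place at hP
  cases hs : gad ψ g with
  | none => rw [hs] at hP; exact absurd hP (by simp)
  | some spec =>
  rw [hs, Option.bind_some] at hP
  unfold gad at hs
  split_ifs at hs with hg hl
  · -- a tile gadget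
    obtain ⟨hi, hj, hgeq⟩ := decode_tile ψ hg
    set i := g / 8 / N ψ with hi_def
    set j := g / 8 % N ψ with hj_def
    have htab : tabOf ψ g = xorTab := by unfold tabOf; rw [if_pos (by omega)]
    have hcases := cellTyAt_tileCell_cases ψ hi hj
    have hvals := ownerTile_vals ψ i j
    have hown : ∀ c < 3, ∀ e, slotOwner ψ (tileCell ψ i j c) e = ownerTile ψ i j c (decide (tileTy ψ i j = .cross)) e :=
      fun c hc e => slotOwner_tileCell ψ hi hj hc e
    unfold tileGad at hs
    split_ifs at hs with hcross h0 hj0 h1 h2 h3 h4 h5 h0' hj0' h1' h2' <;>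
      simp only [Option.some.injEq] at hs <;> subst hs <;> simp only [realize] at hP
    · -- cross, r = 0, j ≠ 0 : the row chord from tile (i, j-1)
      have hj1 : j - 1 < N ψ := by omega
      have hro := rowOutSlot_adj ψ hi hj1
      refine (xorAt?_spec ψ hP hro.2.1 (by rw [(hcases.1 hcross).1]; decide)).placeSpec ?_ htab
      simp only [List.mem_cons, List.not_mem_nil, or_false]
      rintro ke (rfl | rfl)
      · rw [slotOwner_tileCell ψ hi hj1 (by omega), hro.2.2]; omega
      · rw [hown 0 (by omega), decide_eq_true hcross, hvals.1]; omega
    · -- cross, r = 1 : the chord c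
      refine (xorAt?_spec ψ hP (by rw [(hcases.1 hcross).1]; decide) (by rw [(hcases.1 hcross).2.1]; decide)).placeSpec ?_ htab
      simp only [List.mem_cons, List.not_mem_nil, or_false]
      rintro ke (rfl | rfl)
      · rw [hown 0 (by omega), decide_eq_true hcross, hvals.2.2.1]; omega
      · rw [hown 1 (by omega), decide_eq_true hcross, hvals.2.2.2.2.2.1]; omega
    · -- cross, r = 2 : the chord r
      refine (xorAt?_spec ψ hP (by rw [(hcases.1 hcross).1]; decide) (by rw [(hcases.1 hcross).2.1]; decide)).placeSpec ?_ htab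
      simp only [List.mem_cons, List.not_mem_nil, or_false]
      rintro ke (rfl | rfl)
      · rw [hown 0 (by omega), decide_eq_true hcross, hvals.2.2.2.1]; omega
      · rw [hown 1 (by omega), decide_eq_true hcross, hvals.2.2.2.2.2.2.1]; omega
    · -- cross, r = 3 : the chord κ
      refine (xorAt?_spec ψ hP (by rw [(hcases.1 hcross).2.1]; decide) (by rw [(hcases.1 hcross).2.2]; decide)).placeSpec ?_ htab
      simp only [List.mem_cons, List.not_mem_nil, or_false]
      rintro ke (rfl | rfl)
      · rw [hown 1 (by omega), decide_eq_true hcross, hvals.2.2.2.2.2.2.2.1]; omega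
      · rw [hown 2 (by omega), decide_eq_true hcross, hvals.2.2.2.2.2.2.2.2.2.1]; omega
    · -- cross, r = 4 : the chord c'
      refine (xorAt?_spec ψ hP (by rw [(hcases.1 hcross).1]; decide) (by rw [(hcases.1 hcross).2.2]; decide)).placeSpec ?_ htab
      simp only [List.mem_cons, List.not_mem_nil, or_false]
      rintro ke (rfl | rfl)
      · rw [hown 0 (by omega), decide_eq_true hcross, hvals.2.2.2.2.1]; omega
      · rw [hown 2 (by omega), decide_eq_true hcross, hvals.2.2.2.2.2.2.2.2.2.2.1]; omega
    · -- cross, r = 5 : the column chord from tile (i-1, j)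
      have hlt : rowOf ψ (varOf ψ j) < i := (tileTy_eq_cross_iff ψ).1 hcross
      have hi1 : i - 1 < V ψ := by omega
      have hco := colOutSlot_adj ψ hi1 hj (tileTy_ne_empty_of_le ψ (by omega))
      refine (xorAt?_spec ψ hP hco.2.1 (by rw [(hcases.1 hcross).1]; decide)).placeSpec ?_ htab
      simp only [List.mem_cons, List.not_mem_nil, or_false]
      rintro ke (rfl | rfl)
      · rw [slotOwner_tileCell ψ hi1 hj (by omega), hco.2.2]
        unfold colOwner; rw [if_pos (by omega), show i - 1 + 1 = i by omega]; omega
      · rw [hown 0 (by omega), decide_eq_true hcross, hvals.2.1]; omega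
    · -- not cross, r = 0, j ≠ 0 : the row chord from tile (i, j-1)
      have hj1 : j - 1 < N ψ := by omega
      have hro := rowOutSlot_adj ψ hi hj1
      refine (xorAt?_spec ψ hP hro.2.1 (by rw [hcases.2 hcross 0 (by omega)]; decide)).placeSpec ?_ htab
      simp only [List.mem_cons, List.not_mem_nil, or_false]
      rintro ke (rfl | rfl)
      · rw [slotOwner_tileCell ψ hi hj1 (by omega), hro.2.2]; omega
      · rw [hown 0 (by omega), show decide (tileTy ψ i j = TileTy.cross) = false from decide_eq_false hcross,
          hvals.2.2.2.2.2.2.2.2.2.2.2.2.1]; omega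
    · -- not cross, r = 1
      refine (xorAt?_spec ψ hP (by rw [hcases.2 hcross 0 (by omega)]; decide) (by rw [hcases.2 hcross 1 (by omega)]; decide)).placeSpec ?_ htab
      simp only [List.mem_cons, List.not_mem_nil, or_false]
      rintro ke (rfl | rfl)
      · rw [hown 0 (by omega), show decide (tileTy ψ i j = TileTy.cross) = false from decide_eq_false hcross,
          hvals.2.2.2.2.2.2.2.2.2.2.2.2.2.1]; omega
      · rw [hown 1 (by omega), show decide (tileTy ψ i j = TileTy.cross) = false from decide_eq_false hcross,
          hvals.2.2.2.2.2.2.2.2.2.2.2.2.2.2.1]; omega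
    · -- not cross, r = 2
      refine (xorAt?_spec ψ hP (by rw [hcases.2 hcross 1 (by omega)]; decide) (by rw [hcases.2 hcross 2 (by omega)]; decide)).placeSpec ?_ htab
      simp only [List.mem_cons, List.not_mem_nil, or_false]
      rintro ke (rfl | rfl)
      · rw [hown 1 (by omega), show decide (tileTy ψ i j = TileTy.cross) = false from decide_eq_false hcross,
          hvals.2.2.2.2.2.2.2.2.2.2.2.2.2.2.2.1]; omega
      · rw [hown 2 (by omega), show decide (tileTy ψ i j = TileTy.cross) = false from decide_eq_false hcross,
          hvals.2.2.2.2.2.2.2.2.2.2.2.2.2.2.2.2.2.1]; omega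
  · -- the landing chord of column j = g - 8 V N
    simp only [Option.some.injEq] at hs
    subst hs
    simp only [realize] at hP
    set j := g - 8 * (V ψ * N ψ) with hj_def
    have hN : 0 < N ψ := by omega
    have hV : 0 < V ψ := V_pos_of_N_pos ψ hN
    have hVj := rowOf_varOf_lt ψ hl
    have hco := colOutSlot_adj ψ (i := V ψ - 1) (j := j) (by omega) hl (tileTy_ne_empty_of_le ψ (by omega))
    have hls := landSlot_props ψ j
    have htab : tabOf ψ g = xorTab := by unfold tabOf; rw [if_pos (by omega)]
    refine (xorAt?_spec ψ hP hco.2.1 (by rw [cellTyAt_clauseBead]; exact hls.2.1)).placeSpec ?_ htab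
    simp only [List.mem_cons, List.not_mem_nil, or_false]
    rintro ke (rfl | rfl)
    · rw [slotOwner_tileCell ψ (by omega) hl (by omega), hco.2.2]
      unfold colOwner; rw [if_neg (by omega)]; omega
    · rw [slotOwner_clauseBead, if_neg hls.2.2]; omega
  · -- the OR-gadget of clause q = g - 8 V N - N
    set q := g - 8 * (V ψ * N ψ) - N ψ with hq_def
    have htab : tabOf ψ g = orTab := by unfold tabOf; rw [if_neg (by omega)]
    unfold clauseGad at hs
    split_ifs at hs with hq hk1 hk3 <;>
      simp only [Option.some.injEq] at hs <;> subst hs <;> simp only [realize] at hP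
    · refine (or1At?_spec ψ hP (cellTyAt_clauseBead ψ _)).placeSpec ?_ htab
      simp only [List.mem_singleton]
      rintro ke rfl
      rw [slotOwner_clauseBead, if_pos rfl, show cstart ψ q = cstart ψ q + 0 from rfl,
        colClause_cstart_add ψ hq (by omega)]
      omega
    · have hcb : ∀ m < 3, cellTyAt ψ (clauseBead ψ (cstart ψ q) + m) = .bead := fun m _ => by
        rw [show clauseBead ψ (cstart ψ q) + m = clauseBead ψ (cstart ψ q + m) by unfold clauseBead; omega]
        exact cellTyAt_clauseBead ψ _
      refine (or3At?_spec ψ hP hcb).placeSpec ?_ htab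
      simp only [List.mem_cons, List.not_mem_nil, or_false]
      have hcb' : ∀ m, clauseBead ψ (cstart ψ q) + m = clauseBead ψ (cstart ψ q + m) := fun m => by unfold clauseBead; omega
      rintro ke (rfl | rfl | rfl)
      · rw [slotOwner_clauseBead, if_pos rfl, show cstart ψ q = cstart ψ q + 0 from rfl, colClause_cstart_add ψ hq (by omega)]
        omega
      · rw [show (clauseBead ψ (cstart ψ q) + 1, bS0).1 = clauseBead ψ (cstart ψ q + 1) from hcb' 1, slotOwner_clauseBead,
          if_pos rfl, colClause_cstart_add ψ hq (by omega)]
        omega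
      · rw [show (clauseBead ψ (cstart ψ q) + 2, bS0).1 = clauseBead ψ (cstart ψ q + 2) from hcb' 2, slotOwner_clauseBead,
          if_pos rfl, colClause_cstart_add ψ hq (by omega)]
        omega

/-! ### Validity of the family -/

/-- The slots of a gadget are owned, increasing cell edges of existing cells. [folklore] -/
theorem mem_S_spec {g : ℕ} {e : ℕ × ℕ} (he : e ∈ (family ψ).S g) :
    ∃ k e₀, e = gs k e₀ ∧ k < ncells ψ ∧ (cellTyAt ψ k).adjB e₀.1 e₀.2 = true ∧ e₀ ∈ canon (cellTyAt ψ k) ∧ slotOwner ψ k e₀ = g := by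
  rw [family_S] at he
  cases hP : place ψ g with
  | none => rw [hP] at he; simp at he
  | some P =>
    rw [hP] at he
    obtain ⟨r, rfl⟩ := (RailPlacement.mem_S_iff _).1 he
    exact (place_spec ψ hP).2.2.2.1 r

/-- The gadget vertices of gadget `g` lie in its block. [folklore] -/
theorem mem_VX_bounds {g v : ℕ} (hv : v ∈ (family ψ).VX g) : gbase ψ g ≤ v ∧ v < gbase ψ g + 64 := by
  rw [family_VX] at hv
  cases hP : place ψ g with
  | none => rw [hP] at hv; simp at hv
  | some P =>
    rw [hP] at hv
    obtain ⟨hb, hsize, -⟩ := place_spec ψ hP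
    have := P.mem_VX_bounds hv
    omega

/-- Chain vertices are below every gadget base. [folklore] -/
theorem lt_gbase_of_mem_chainVerts {v : ℕ} (hv : v ∈ chainVerts (cellsOf ψ)) (g : ℕ) : v < gbase ψ g := by
  obtain ⟨i, hi, rfl | ⟨j, -, rfl⟩⟩ := eq_conn_or_eq_vtx_of_mem hv
  · rw [length_cellsOf] at hi; unfold conn gbase; nlinarith
  · rw [length_cellsOf] at hi; exact vtx_lt_gbase ψ hi j g

/-- Gadget vertices are fresh. [folklore] -/
theorem V_disjoint (g : ℕ) : Disjoint (chainVerts (cellsOf ψ)) ((family ψ).VX g) := by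
  rw [Finset.disjoint_left]
  intro v hv hv'
  exact absurd (mem_VX_bounds ψ hv').1 (not_le.2 (lt_gbase_of_mem_chainVerts ψ hv g))

/-- Gadget vertex blocks are pairwise disjoint. [folklore] -/
theorem VX_disjoint {g g' : ℕ} (hne : g ≠ g') : Disjoint ((family ψ).VX g) ((family ψ).VX g') := by
  rw [Finset.disjoint_left]
  intro v hv hv'
  have h1 := mem_VX_bounds ψ hv
  have h2 := mem_VX_bounds ψ hv'
  unfold gbase at h1 h2
  rcases Nat.lt_or_gt_of_ne hne with h | h
  · have : 64 * g + 64 ≤ 64 * g' := by omega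
    omega
  · have : 64 * g' + 64 ≤ 64 * g := by omega
    omega

/-- Slots are chain edges inside the chain. [folklore] -/
theorem slot_adj {g : ℕ} {e : ℕ × ℕ} (he : e ∈ (family ψ).S g) :
    e.1 ∈ chainVerts (cellsOf ψ) ∧ e.2 ∈ chainVerts (cellsOf ψ) ∧ (GridCell.chainG (cellsOf ψ)).Adj e.1 e.2 := by
  obtain ⟨k, e₀, rfl, hk, hadj, -, -⟩ := mem_S_spec ψ he
  have hk' : k < (cellsOf ψ).length := by rwa [length_cellsOf]
  rw [← cellTy_cellsOf ψ hk] at hadj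
  have h := gs_adj hk' hadj
  exact ⟨(mem_chainVerts_of_adj h).1, (mem_chainVerts_of_adj h).2, h⟩

/-- **Slots of different gadgets are different edges** (by ownership). [folklore] -/
theorem slot_across {g g' : ℕ} (hne : g ≠ g') {e : ℕ × ℕ} (he : e ∈ (family ψ).S g) : ¬ slotOf ((family ψ).S g') e.1 e.2 := by
  obtain ⟨k, e₀, rfl, -, -, ho, hown⟩ := mem_S_spec ψ he
  rintro (h | h)
  · obtain ⟨k', e₀', h1, -, -, -, hown'⟩ := mem_S_spec ψ h
    obtain ⟨rfl, rfl⟩ := (gs_inj).1 h1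
    exact hne (hown.symm.trans hown')
  · obtain ⟨k', e₀', h1, -, -, ho', -⟩ := mem_S_spec ψ h
    simp only [gs, Prod.mk.injEq, vtx_inj] at h1
    obtain ⟨⟨rfl, h2⟩, ⟨-, h3⟩⟩ := h1
    have : e₀' = (e₀.2, e₀.1) := Prod.ext h2.symm h3.symm
    rw [this] at ho'
    exact canon_swap _ e₀ ho ho'

/-- Slots of one gadget have pairwise distinct ends. [folklore] -/
theorem slot_disjoint (g : ℕ) : ∀ e ∈ (family ψ).S g, ∀ e' ∈ (family ψ).S g, e ≠ e' →
    e.1 ≠ e'.1 ∧ e.1 ≠ e'.2 ∧ e.2 ≠ e'.1 ∧ e.2 ≠ e'.2 := by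
  intro e he e' he' hne
  rw [family_S] at he he'
  cases hP : place ψ g with
  | none => rw [hP] at he; simp at he
  | some P =>
    rw [hP] at he he'
    obtain ⟨r, rfl⟩ := (RailPlacement.mem_S_iff P).1 he
    obtain ⟨r', rfl⟩ := (RailPlacement.mem_S_iff P).1 he'
    exact P.ends_distinct r r' fun h => hne (by rw [h])

/-- Gadget edges attach to ports only. [folklore] -/
theorem gadget_adj (g : ℕ) : ∀ a b, ((family ψ).GX g).Adj a b →
    (a ∈ (family ψ).VX g ∨ b ∈ (family ψ).VX g) ∧ (a ∈ (family ψ).VX g ∨ a ∈ ports ((family ψ).S g)) ∧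
      (b ∈ (family ψ).VX g ∨ b ∈ ports ((family ψ).S g)) := by
  intro a b hab
  rw [family_GX] at hab
  rw [family_VX, family_S]
  cases hP : place ψ g with
  | none => rw [hP] at hab; exact absurd hab (by simp)
  | some P => rw [hP] at hab; exact P.gadget_adj a b hab

/-- One port edge at each port. [folklore] -/
theorem port_unique (g : ℕ) : ∀ p ∈ ports ((family ψ).S g), ∀ x y, ((family ψ).GX g).Adj p x →
    ((family ψ).GX g).Adj p y → x = y := by
  intro p hp x y hx hy
  rw [family_S] at hp
  rw [family_GX] at hx hy
  cases hP : place ψ g with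
  | none => rw [hP] at hx; exact absurd hx (by simp)
  | some P => rw [hP] at hp hx hy; exact P.port_unique p hp x y hx hy

/-- Every gadget is exclusive. [folklore] -/
theorem exclusive (g : ℕ) : Exclusive ((family ψ).GX g) ((family ψ).VX g) ((family ψ).S g) := by
  rw [family_S, family_GX, family_VX]
  cases hP : place ψ g with
  | none =>
    intro T h1 _ _ _ τ hτ
    exact absurd (h1 τ hτ).1 (by simp [ports])
  | some P => exact P.exclusive (place_spec ψ hP).2.2.1

/-- **The gadget family of a formula is valid** (for any number of gadgets). [folklore] -/
theorem valid (n : ℕ) : GadgetFamily.Valid (GridCell.chainG (cellsOf ψ)) (chainVerts (cellsOf ψ)) (family ψ) n :=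
  ⟨fun g _ => V_disjoint ψ g, fun _ _ _ _ hne => VX_disjoint ψ hne, fun _ _ _ he => slot_adj ψ he,
    fun _ _ _ _ hne _ he => slot_across ψ hne he, fun g _ => slot_disjoint ψ g, fun g _ => gadget_adj ψ g,
    fun g _ => port_unique ψ g, fun g _ => exclusive ψ g⟩

/-- **The census of every placed gadget is its table.** [folklore] -/
theorem coverCount_family_some {g : ℕ} {P : RailPlacement} (hP : place ψ g = some P) (U : Finset (ℕ × ℕ))
    (hU : U ⊆ (family ψ).S g) :
    coverCount ((family ψ).GX g) ((family ψ).VX g) U = if tabOf ψ g U = true then 1 else 0 := by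
  rw [family_S, hP] at hU
  rw [family_GX, family_VX, hP]
  exact (place_spec ψ hP).2.2.2.2 U hU

/-- An absent gadget has no slots. [folklore] -/
theorem family_S_none {g : ℕ} (hP : place ψ g = none) : (family ψ).S g = ∅ := by
  rw [family_S, hP]; rfl

/-- **The empty gadget has exactly one (empty) cover** (local copy; the same statement is
`FormulaGraph.coverCount_bot_empty` of `FormulaGraphCount.lean`, whose import closure is not wanted here).
[folklore] -/
private theorem coverCount_bot_empty : coverCount (⊥ : _root_.SimpleGraph ℕ) ∅ ∅ = 1 := by
  have : coverSet (⊥ : _root_.SimpleGraph ℕ) ∅ ∅ = {fun _ => []} := by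
    ext f
    simp only [coverSet, Set.mem_setOf_eq, IsCover, Set.mem_singleton_iff]
    constructor
    · rintro ⟨-, h, -, -⟩
      funext e
      exact h e (by simp)
    · rintro rfl
      exact ⟨fun e he => absurd he (by simp), fun _ _ => rfl, fun e he => absurd he (by simp), fun x hx => absurd hx (by simp)⟩
  rw [coverCount, this, Set.ncard_singleton]

/-- The census of an absent gadget (on its only slot set `∅`) is `1`. [folklore] -/
theorem coverCount_family_none {g : ℕ} (hP : place ψ g = none) :
    coverCount ((family ψ).GX g) ((family ψ).VX g) ∅ = 1 := by
  rw [family_GX, family_VX, hP]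
  exact coverCount_bot_empty

end GridFormula

end Literature.Combinatorics.SimpleGraph
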